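import Literature.IUT.HodgeTheaters.GlobalFrobenioidsCoricFieldLevelArithmeticModel
import Literature.IUT.HodgeTheaters.GlobalFrobenioidsCyclotomes
import Mathlib.Algebra.Algebra.Hom.Rat
import Mathlib.FieldTheory.AlgebraicClosure
import Mathlib.FieldTheory.RatFunc.IntermediateField
import HarnessLib

/-!
# [IUTchI] Example 5.1 (v): the ∞κ and the FAITHFUL ∞κ× field-level binder sets and the schemas
# F-2571/F-2572/F-2575, jointly inhabited at the arithmetic function-field model (PROOF-ONLY; NV annex A3×)

Mochizuki, *Inter-universal Teichmüller theory I*, kurims manuscript (May 2020).  §5 Example 5.1 (i), p. 123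
l. 56 – p. 124 l. 7 (cell render lit/IUTchI-EX51-i-iv-vii-VERBATIM.md l.17): "we conclude that we may construct
group-theoretically from `π₁(†𝒟^⊚)`, in a functorial fashion, an isomorph `π₁^rat(†𝒟^⊛) (↠ π₁(†𝒟^⊛))` of the
absolute Galois group of the function field of `C_{F_mod}` […], as well as isomorphs of the pseudo-monoids of
`κ`-, `∞κ`-, and `∞κ×`-coric rational functions associated to `C_{F_mod}` […] — equipped with their natural
`π₁^rat(†𝒟^⊛)`-actions."; p. 124 l. 13–20 (ibid. l.18): "Thus, `𝕄^⊛_κ(†𝒟^⊚)` may be identified with the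
subset of `π₁^rat(†𝒟^⊛)`-invariants of `𝕄^⊛_∞κ(†𝒟^⊚)`, and `𝕄^⊛(†𝒟^⊚)` may be identified with a certain subset
[i.e., indeed, a certain “sub-pseudo-monoid”!] of `𝕄^⊛_∞κ×(†𝒟^⊚)`."; §3 Remark 3.1.7 (ii), p. 67 l. 36–42
(render lit/renders/IUTchI-SEC3-6-DECORATED.txt l.81): "If `L = F_mod`, then write `U_L̄` for the group `L̄^×` of
nonzero elements of `L̄` […]. We shall say that an element `f ∈ L̄_C` is `∞κ`-coric if there exists a positive
integer `n` such that `fⁿ` is a `κ`-coric element of `L_C`; we shall say that an element `f ∈ L_C` is `∞κ×`-coric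
if there exists an element `c ∈ U_L̄` such that `c · f ∈ L̄_C` is `∞κ`-coric." (the tree — abc-iut-L5-t2's
`CriticalLocus.IsInftyKappaUnitCoricIn` — reads the `∞κ×`-coric elements in `L̄_C`, as (v) p. 128
"`(𝕄^⊛_∞κ×(†𝒟^⊚))^× = 𝕄^⊛(†𝒟^⊚)`" forces; reading of record `U_L̄ = L̄^×`: abc-iut-L5-lead RULINGS #76 (b)).
([IUTchI] Ex 5.1 (v) pp.127–128; (i) pp.123–124; Rmk 3.1.7 (ii) p.67) [claim: Mochizuki2012, status: disputed]
(D-0012 claim key; everything below is a MODEL in elementary field theory; nothing disputed is asserted).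

WHAT (cell abc-iut, CERT-L5 NV column; abc-iut-w4-d050 gen 6; sequel to the NV annex A3 = p452371
`exists_infκ_fieldLevel_laws_arithmetic`, whose ∞κ× side was COLLAPSED onto the ∞κ side and whose Galois side was
tautological).  PROOF-ONLY (no `def`, `instance`, `structure`, Prop fact).  ONE datum `N : NFBridgeRecon`:
`L := ℚ`, `S := {0, 9, 16}`, `K_rat := Λ := (ℚ(t))‾` (playing `L̄_C`), `π₁^rat := Gal(Λ/ℚ(t))` (Krull topology);
`𝕄̄^⊛ := ℚ̄ ⊆ Λ` = Mathlib's relative algebraic closure `algebraicClosure ℚ Λ` with the RESTRICTED action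
(`π₁(†𝒟^⊛) := π₁^rat`), `const :=` the inclusion; `𝕄^⊛_∞κ :=` the ∞κ-coric elements (abc-iut-L5-t2), `𝕄^⊛_κ :=`
their `π₁^rat`-invariants; **`𝕄^⊛_∞κ× := {f | ∃ c ∈ U_L̄ = ℚ̄^×, c·f ∞κ-coric}` — print's definition ON THE NOSE**;
`X := ℚ`, `ord_x :=` order of vanishing (as in A3).  PROVED there (`exists_faithful_fieldLevel_laws_arithmetic`):
`hroot`, `hprim`, structural `hfg`, the old law (iv) `hdiv`, `hordmul`; [∞κ] `h1 hpow hpole hex`; **[∞κ×]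
`h1× hpow×` (roots of algebraic constants are algebraic) `hpole×` (KEY: a `π₁^rat`-fixed ∞κ×-coric `q ∈ ℚ(t)` with
`(c·q)ⁿ = g` `κ`-coric has `cⁿ = g/qⁿ ∈ ℚ(t) ∩ ℚ̄ = ℚ` — Mathlib `RatFunc.transcendental_of_ne_C` — so `qⁿ` has the
divisor of `g`: at most one pole) `hex×`**; the FACT-LIST schemas **F-2571 `MκIsInvariants`, F-2572
`ConstantsInfκx`, F-2575 `InfκxUnitsEqConstants`** ("`(𝕄^⊛_∞κ×)^× = 𝕄^⊛`": `f, f⁻¹` both ∞κ×-coric forces `f` to be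
a nonzero CONSTANT, by `gᵐ·g′ⁿ = (cc′)ⁿᵐ ∈ ℚ` and abc-iut-L5-d3's `IsKappaCoric.exists_eq_C_of_mul_eq_C`); `const`
injective; `𝕄^⊛_∞κ ⊊ 𝕄^⊛_∞κ×` (`2` is ∞κ×- but not ∞κ-coric).  Then BOTH `_of_fg` closers (p447949) FIRE at this datum
as TYPED theorems (`exists_faithful_fieldLevel_of_fg_fire_arithmetic`; types A3's «∞κ× closer fires» remark).

HONEST LABEL: NV annex (A3×) «[arithmetic function-field model; ∞κ and ∞κ× sides faithful (`U_L̄ = L̄^×`); constants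
`ℚ̄` with restricted Galois action; `π₁(†𝒟^⊛) := π₁^rat` (no curve quotient); critical points rational]»; a model
witnesses JOINT SATISFIABILITY of OUR typed binders/schemas at a print-shaped datum, nothing about the genuine
`C_{F_mod}`; inhabited ≠ discharged; no census change; typed ≠ proved; no side taken on [IUTchIII] Cor. 3.12.
-/

noncomputable section

namespace Literature.IUT.HodgeTheaters

namespace NFBridgeRecon

namespace CoricArithmeticToy

open Polynomial CriticalLocus
open scoped IntermediateField Classical

/-- `K` is algebraically closed in `K(t)`: a rational function algebraic over the constant field is a constant
(contrapositive of Mathlib's `RatFunc.transcendental_of_ne_C`). [folklore] -/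
private theorem ratFunc_eq_C_of_isAlgebraic {K : Type*} [Field K] (r : RatFunc K) (hr : IsAlgebraic K r) :
    ∃ a : K, r = RatFunc.C a := by
  by_contra hne
  exact RatFunc.transcendental_of_ne_C r hne hr

/-- The strictly critical locus `S := {0, 9, 16} ⊆ ℚ` has three points (re-proved; A3's copy is private). [folklore] -/
private theorem card_S' : ({0, 9, 16} : Finset ℚ).card = 3 := by
  rw [Finset.card_insert_of_notMem (by norm_num), Finset.card_insert_of_notMem (by norm_num),
    Finset.card_singleton]

/-- **A3× — ONE print-shaped datum inhabiting the ∞κ and the FAITHFUL ∞κ× field-level binder sets together with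
F-2571/F-2572/F-2575.**  `K_rat := (ℚ(t))‾`, `π₁^rat := Gal((ℚ(t))‾/ℚ(t))`, `𝕄̄^⊛ := ℚ̄ ⊆ K_rat` (restricted action,
`const` = inclusion), `𝕄^⊛_∞κ :=` ∞κ-coric elements for `S = {0, 9, 16}`, `𝕄^⊛_κ :=` their invariants,
`𝕄^⊛_∞κ× := {f | ∃ c ∈ ℚ̄^×, c·f ∞κ-coric}`, `X := ℚ`, `ord :=` order of vanishing: `hroot` · `hprim` · `hfg` · (iv)
`hdiv` · `hordmul` · [∞κ] `h1 hpow hpole hex` · [∞κ×] `h1× hpow× hpole× hex×` (verbatim binder shapes of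
`existsUniqueCoricStructure_infκ(x)Pair_fieldLevel(_of_fg)`) · `MκIsInvariants` · `ConstantsInfκx` ·
`InfκxUnitsEqConstants` · `const` injective · `𝕄^⊛_∞κ ⊆ 𝕄^⊛_∞κ×`, `𝕄^⊛_∞κ ≠ 𝕄^⊛_∞κ×`.  NV annex; inhabited ≠ discharged.
([IUTchI] Ex 5.1 (v) pp.127–128; Ex 5.1 (i) p.124; Rmk 3.1.7 (ii) p.67) [claim: Mochizuki2012, status: disputed] -/
theorem exists_faithful_fieldLevel_laws_arithmetic :
    ∃ (N : NFBridgeRecon.{0}) (_ : CharZero N.Krat) (X : Type) (ord : X → N.Krat → ℤ),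
      (∀ a : N.Krat, a ≠ 0 → ∀ n : ℕ, 0 < n → ∃ b : N.Krat, b ^ n = a) ∧
      (∀ n : ℕ, 0 < n → ∃ ζ : N.Krat, IsPrimitiveRoot ζ n) ∧
      (∀ H : OpenNormalSubgroup N.piRat, ∃ s : Finset N.Krat,
        ∀ a : N.Krat, (∀ h : N.piRat, h ∈ H → h • a = a) → a ∈ IntermediateField.adjoin ℚ (s : Set N.Krat)) ∧
      (∀ (H : OpenNormalSubgroup N.piRat) (a : N.Krat), a ≠ 0 → (∀ h : N.piRat, h ∈ H → h • a = a) →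
        (∀ n : ℕ+, ∃ b : N.Krat, (∀ h : N.piRat, h ∈ H → h • b = b) ∧ b ^ (n : ℕ) = a) → a = 1) ∧
      (∀ (x : X) (a b : N.Krat), a ≠ 0 → b ≠ 0 → (∀ g : N.piRat, g • a = a) → (∀ g : N.piRat, g • b = b) →
        ord x (a * b) = ord x a + ord x b) ∧
      (1 : N.Krat) ∈ N.Minfκ ∧
      (∀ (f : N.Krat) (n : ℕ), 0 < n → (f ∈ N.Minfκ ↔ f ^ n ∈ N.Minfκ)) ∧
      (∀ f' ∈ N.Minfκ, (∀ g : N.piRat, g • f' = f') →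
        ∀ x₁ x₂ : X, x₁ ≠ x₂ → ¬ (ord x₁ f' < 0 ∧ ord x₂ f' < 0)) ∧
      (∃ f ∈ N.Minfκ, (∀ g : N.piRat, g • f = f) ∧ ∃ x₁ x₂ : X, x₁ ≠ x₂ ∧ 0 < ord x₁ f ∧ 0 < ord x₂ f) ∧
      (1 : N.Krat) ∈ N.Minfκx ∧
      (∀ (f : N.Krat) (n : ℕ), 0 < n → (f ∈ N.Minfκx ↔ f ^ n ∈ N.Minfκx)) ∧
      (∀ f' ∈ N.Minfκx, (∀ g : N.piRat, g • f' = f') →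
        ∀ x₁ x₂ : X, x₁ ≠ x₂ → ¬ (ord x₁ f' < 0 ∧ ord x₂ f' < 0)) ∧
      (∃ f ∈ N.Minfκx, (∀ g : N.piRat, g • f = f) ∧ ∃ x₁ x₂ : X, x₁ ≠ x₂ ∧ 0 < ord x₁ f ∧ 0 < ord x₂ f) ∧
      N.MκIsInvariants ∧ N.ConstantsInfκx ∧ N.InfκxUnitsEqConstants ∧ Function.Injective N.const ∧
      N.Minfκ ⊆ N.Minfκx ∧ N.Minfκ ≠ N.Minfκx := by
  classical
  set S : CriticalLocus ℚ := ⟨{0, 9, 16}, card_S'⟩ with hS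
  let F : Type := RatFunc ℚ
  let K : Type := AlgebraicClosure F
  haveI hGal : IsGalois F K := isGalois_algebraicClosure_ratFunc (Ω := ℚ)
  let G : ProfiniteGrp.{0} := ProfiniteGrp.of (K ≃ₐ[F] K)
  let ρ : G →ₜ* (K ≃ₐ[F] K) := ContinuousMonoidHom.id G
  letI act : MulSemiringAction G K := MulSemiringAction.compHom K (ρ : G →* (K ≃ₐ[F] K))
  have hsmul : ∀ (g : G) (f : K), g • f = (g : K ≃ₐ[F] K) f := fun _ _ => rfl
  let ι : F →+* K := algebraMap F K
  have hinj : Function.Injective ι := (algebraMap F K).injective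
  have hopen : ∀ x : K, IsOpen (MulAction.stabilizer G x : Set G) := by
    intro x
    haveI : FiniteDimensional F F⟮x⟯ :=
      IntermediateField.adjoin.finiteDimensional (Algebra.IsIntegral.isIntegral x)
    have hopen' : IsOpen (MulAction.stabilizer (K ≃ₐ[F] K) x : Set (K ≃ₐ[F] K)) := by
      refine Subgroup.isOpen_mono (fun σ hσ => ?_) (IntermediateField.fixingSubgroup_isOpen F⟮x⟯)
      exact (IntermediateField.mem_fixingSubgroup_iff _ _).1 hσ x (IntermediateField.mem_adjoin_simple_self F x)
    exact hopen'.preimage ρ.continuous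
  have hfixed : ∀ f : K, (∀ g : G, g • f = f) → ∃ q : F, f = ι q := fun f hf => by
    obtain ⟨q, hq⟩ := IntermediateField.mem_bot.1 ((InfiniteGalois.mem_bot_iff_fixed f).2 fun g => hf g)
    exact ⟨q, hq.symm⟩
  have hfix_alg : ∀ (q : F) (g : G), g • ι q = ι q := fun q g => (g : K ≃ₐ[F] K).commutes q
  have hCK : ∀ r : ℚ, ι (RatFunc.C r) = (r : K) := fun r => by rw [eq_ratCast, map_ratCast]
  let E : IntermediateField ℚ K := algebraicClosure ℚ K
  have hmemE : ∀ {x : K}, x ∈ E ↔ IsAlgebraic ℚ x := fun {x} => mem_algebraicClosure_iff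
  have hE_smul : ∀ (g : G) {x : K}, x ∈ E → g • x ∈ E := by
    intro g x hx
    rw [hsmul]
    exact (map_mem_algebraicClosure_iff (((g : K ≃ₐ[F] K) : K →+* K).toRatAlgHom)).mpr hx
  have hratE : ∀ r : ℚ, (r : K) ∈ E := fun r => SubfieldClass.ratCast_mem E r
  -- `ℚ` is algebraically closed in `ℚ(t)`: a rational function lying in `ℚ̄` is a constant
  have hconst : ∀ r : F, ι r ∈ E → ∃ a : ℚ, r = RatFunc.C a := by
    intro r hr
    obtain ⟨p, hp0, hp⟩ := hmemE.mp hr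
    letI : Algebra ℚ F := RatFunc.instAlgebraOfPolynomial ℚ ℚ
    have h1 := Polynomial.aeval_algHom_apply ι.toRatAlgHom r p
    rw [RingHom.toRatAlgHom_apply] at h1
    have h3 : Polynomial.aeval r p = 0 :=
      hinj (by rw [map_zero, ← RingHom.toRatAlgHom_apply, ← h1]; exact hp)
    exact ratFunc_eq_C_of_isAlgebraic r ⟨p, hp0, h3⟩
  -- the ∞κ-coric elements `T` and the ∞κ×-coric elements `Tx` (unit parameter `U_L̄ = ℚ̄^×`)
  let T : Set K := {f | S.IsInftyKappaCoricIn K f}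
  let Tx : Set K := {f | ∃ c : K, c ∈ E ∧ c ≠ 0 ∧ c * f ∈ T}
  have hT1 : (1 : K) ∈ T := S.isInftyKappaCoricIn_of_pow_eq_one K Nat.one_pos (one_pow 1)
  have hT0 : (0 : K) ∉ T := by
    rintro ⟨n, hn, g, hg, h⟩
    rw [zero_pow hn.ne', eq_comm, map_eq_zero_iff _ hinj] at h
    exact hg.ne_zero S h
  have hTpow : ∀ (f : K) (n : ℕ), 0 < n → (f ∈ T ↔ f ^ n ∈ T) := fun f n hn =>
    (S.isInftyKappaCoricIn_pow_iff K hn f).symm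
  have hTsmul : ∀ (g : G) {f : K}, f ∈ T → g • f ∈ T := fun g f hf => by
    rw [hsmul]
    exact hf.map_algEquiv S K _
  have hTTx : T ⊆ Tx := fun f hf => ⟨1, E.one_mem, one_ne_zero, by rwa [one_mul]⟩
  have hTx1 : (1 : K) ∈ Tx := hTTx hT1
  have hTx0 : (0 : K) ∉ Tx := fun ⟨c, _, _, hc⟩ => hT0 (by rwa [mul_zero] at hc)
  have hTxsmul : ∀ (g : G) {f : K}, f ∈ Tx → g • f ∈ Tx := by
    rintro g f ⟨c, hcE, hc0, hcf⟩
    refine ⟨g • c, hE_smul g hcE, ?_, ?_⟩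
    · rw [hsmul]; exact (map_ne_zero_iff _ (g : K ≃ₐ[F] K).injective).mpr hc0
    · rw [← smul_mul']; exact hTsmul g hcf
  have hconstTx : ∀ c : K, c ∈ E → c ≠ 0 → c ∈ Tx := fun c hcE hc0 =>
    ⟨c⁻¹, E.inv_mem hcE, inv_ne_zero hc0, by rw [inv_mul_cancel₀ hc0]; exact hT1⟩
  have hTxpow : ∀ (f : K) (n : ℕ), 0 < n → (f ∈ Tx ↔ f ^ n ∈ Tx) := by
    intro f n hn
    constructor
    · rintro ⟨c, hcE, hc0, hcf⟩
      refine ⟨c ^ n, pow_mem hcE n, pow_ne_zero n hc0, ?_⟩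
      rw [← mul_pow]
      exact (hTpow _ n hn).mp hcf
    · rintro ⟨c, hcE, hc0, hcf⟩
      obtain ⟨d, hd⟩ := IsAlgClosed.exists_pow_nat_eq c hn
      have hd0 : d ≠ 0 := fun h0 => hc0 (by rw [← hd, h0, zero_pow hn.ne'])
      have hdE : d ∈ E := hmemE.mpr (IsAlgebraic.of_pow hn (by rw [hd]; exact hmemE.mp hcE))
      refine ⟨d, hdE, hd0, (hTpow _ n hn).mpr ?_⟩
      rw [mul_pow, hd]
      exact hcf
  -- the KEY divisor step: `f, f⁻¹ ∈ Tx` forces `f` to be a nonzero constant (F-2575, "(𝕄_∞κ×)^× = 𝕄^⊛")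
  have hunits : ∀ f : K, f ∈ Tx → f⁻¹ ∈ Tx → f ≠ 0 ∧ f ∈ E := by
    rintro f ⟨c, hcE, hc0, n, hn, g, hg, hcf⟩ ⟨c', hc'E, hc'0, m, hm, g', hg', hcf'⟩
    have hf0 : f ≠ 0 := by
      rintro rfl
      rw [mul_zero, zero_pow hn.ne', eq_comm, map_eq_zero_iff _ hinj] at hcf
      exact hg.ne_zero S hcf
    have e1 : ι (g ^ m * g' ^ n) = (c * c') ^ (n * m) := by
      rw [map_mul, map_pow, map_pow, ← hcf, ← hcf', ← pow_mul, ← pow_mul, mul_comm m n, ← mul_pow,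
        mul_mul_mul_comm, mul_inv_cancel₀ hf0, mul_one]
    have hprodE : ι (g ^ m * g' ^ n) ∈ E := e1 ▸ pow_mem (E.mul_mem hcE hc'E) _
    obtain ⟨a, ha⟩ := hconst _ hprodE
    have ha0 : a ≠ 0 := by
      rintro rfl
      rw [map_zero, mul_eq_zero, pow_eq_zero_iff hm.ne', pow_eq_zero_iff hn.ne'] at ha
      exact ha.elim (hg.ne_zero S) (hg'.ne_zero S)
    obtain ⟨b, hb⟩ := IsKappaCoric.exists_eq_C_of_mul_eq_C S (hg.pow S hm) (hg'.pow S hn) ha0 ha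
    have hfpow : f ^ (n * m) = (b : K) * (c ^ (n * m))⁻¹ := by
      have h1 : (c * f) ^ (n * m) = (b : K) := by rw [pow_mul, hcf, ← map_pow, hb, hCK]
      rw [mul_pow] at h1
      rw [← h1, mul_comm (c ^ (n * m)), mul_assoc, mul_inv_cancel₀ (pow_ne_zero _ hc0), mul_one]
    have hfE : f ^ (n * m) ∈ E := by
      rw [hfpow]
      exact E.mul_mem (hratE b) (E.inv_mem (pow_mem hcE _))
    exact ⟨hf0, hmemE.mpr (IsAlgebraic.of_pow (Nat.mul_pos hn hm) (hmemE.mp hfE))⟩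
  letI actE : MulSemiringAction G E :=
    { smul := fun g x => ⟨g • (x : K), hE_smul g x.2⟩
      one_smul := fun x => Subtype.ext (one_smul G (x : K))
      mul_smul := fun g h x => Subtype.ext (mul_smul g h (x : K))
      smul_zero := fun g => Subtype.ext (smul_zero g)
      smul_add := fun g x y => Subtype.ext (smul_add g (x : K) (y : K))
      smul_one := fun g => Subtype.ext (smul_one g)
      smul_mul := fun g x y => Subtype.ext (MulSemiringAction.smul_mul g (x : K) (y : K)) }
  have hsmulE : ∀ (g : G) (x : E), ((g • x : E) : K) = g • (x : K) := fun _ _ => rfl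
  have hopenE : ∀ x : E, IsOpen (MulAction.stabilizer G x : Set G) := fun x => by
    have hst : (MulAction.stabilizer G x : Set G) = (MulAction.stabilizer G (x : K) : Set G) := by
      refine Set.ext fun g => ?_
      simp only [SetLike.mem_coe, MulAction.mem_stabilizer_iff]
      exact ⟨fun h => by rw [← hsmulE, h], fun h => Subtype.ext (by rw [hsmulE, h])⟩
    exact hst ▸ hopen _
  let N : NFBridgeRecon.{0} :=
    { l := 5, piDast := G, piDcirc := ⊤
      Fbar := E, fbarField := inferInstance, fbarAction := actE, isOpen_stabilizer_fbar := hopenE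
      piRat := G, ratToAst := ContinuousMonoidHom.id G, ratToAst_surjective := Function.surjective_id
      Krat := K, kratField := inferInstance, kratAction := act, isOpen_stabilizer_krat := hopen
      const := (algebraMap E K : E →+* K)
      const_smul := fun _ _ => rfl
      Mκ := {f | f ∈ T ∧ ∀ g : G, g • f = f}
      Minfκ := T
      Minfκx := Tx
      mκ_subset := fun _ hf => hf.1
      minfκ_subset := hTTx
      zero_notMem := hTx0
      smul_mem_minfκ := fun g _ hf => hTsmul g hf
      smul_mem_minfκx := fun g _ hf => hTxsmul g hf
      solKer := ⊤, solKer_normal := inferInstance, AutD := PUnit, autGroup := inferInstance, Autε := ⊤, AutSL := ⊤,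
      AutSLε := ⊤, autSLε_le := le_rfl, autSLε_le_autε := le_rfl, lift := fun _ => ContinuousMulEquiv.refl G }
  have hconst_apply : ∀ x : E, N.const x = (x : K) := fun _ => rfl
  let ordF : ℚ → F → ℤ := fun x c => (c.num.rootMultiplicity x : ℤ) - c.denom.rootMultiplicity x
  let ordK : ℚ → K → ℤ := fun x f => if h : ∃ c : F, f = ι c then ordF x h.choose else 0
  have ord_alg : ∀ (x : ℚ) (c : F), ordK x (ι c) = ordF x c := by
    intro x c
    have hh : ∃ c' : F, ι c = ι c' := ⟨c, rfl⟩
    have h1 : ordK x (ι c) = ordF x hh.choose := dif_pos hh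
    rw [h1, ← hinj hh.choose_spec]
  have ordF_C : ∀ (x : ℚ) (b : ℚ), ordF x (RatFunc.C b) = 0 := fun x b => by
    simp only [ordF, RatFunc.num_C, RatFunc.denom_C, Polynomial.rootMultiplicity_C, ← Polynomial.C_1]
    simp
  let t' : K := ι (algebraMap ℚ[X] F X)
  have hpoly : ∀ (L : Subfield K), t' ∈ L → ∀ p : ℚ[X], ι (algebraMap ℚ[X] F p) ∈ L := by
    intro L ht p
    induction p using Polynomial.induction_on' with
    | add p q hp hq => rw [map_add, map_add]; exact L.add_mem hp hq
    | monomial n r =>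
      rw [← C_mul_X_pow_eq_monomial, map_mul, map_pow, map_mul, map_pow, RatFunc.algebraMap_C]
      refine L.mul_mem ?_ (L.pow_mem ht n)
      rw [hCK]
      exact SubfieldClass.ratCast_mem L r
  have hrat : ∀ (L : Subfield K), t' ∈ L → ∀ c : F, ι c ∈ L := by
    intro L ht c
    refine RatFunc.induction_on (P := fun c : F => ι c ∈ L) c fun p q _ => ?_
    rw [map_div₀]
    exact L.div_mem (hpoly L ht p) (hpoly L ht q)
  have hfgN : ∀ H : OpenNormalSubgroup N.piRat, ∃ s : Finset N.Krat,
      ∀ a : N.Krat, (∀ h : N.piRat, h ∈ H → h • a = a) → a ∈ IntermediateField.adjoin ℚ (s : Set N.Krat) := by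
    intro H
    let Hs : Subgroup (K ≃ₐ[F] K) := H.toSubgroup
    let EH : IntermediateField F K := IntermediateField.fixedField Hs
    have hmemEH : ∀ y : K, (∀ h : G, h ∈ H → h • y = y) → y ∈ EH := fun y hy =>
      (IntermediateField.mem_fixedField_iff _ _).mpr fun f hf => hy f hf
    let Hc : ClosedSubgroup (K ≃ₐ[F] K) := ⟨Hs, H.toOpenSubgroup.isClosed⟩
    have hfix : EH.fixingSubgroup = Hs := InfiniteGalois.fixingSubgroup_fixedField Hc
    haveI : FiniteDimensional F EH := (InfiniteGalois.isOpen_iff_finite EH).1 (hfix ▸ H.toOpenSubgroup.isOpen')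
    let b := Module.finBasis F EH
    let s : Finset K := insert t' (Finset.univ.image fun i => ((b i : EH) : K))
    refine ⟨s, fun a hfa => ?_⟩
    let L : Subfield K := Subfield.closure (s : Set K)
    have htL : t' ∈ L := Subfield.subset_closure (Finset.mem_coe.mpr (Finset.mem_insert_self _ _))
    have hbL : ∀ i, ((b i : EH) : K) ∈ L := fun i =>
      Subfield.subset_closure (Finset.mem_coe.mpr
        (Finset.mem_insert_of_mem (Finset.mem_image.mpr ⟨i, Finset.mem_univ i, rfl⟩)))
    have haE : a ∈ EH := hmemEH a hfa
    set e : EH := ⟨a, haE⟩ with he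
    have hrepr := b.sum_repr e
    have ha_eq : a = ∑ i, ι (b.repr e i) * ((b i : EH) : K) := by
      have h1 : a = ((∑ i, b.repr e i • b i : EH) : K) := by rw [hrepr]
      rw [h1, IntermediateField.coe_sum]
      refine Finset.sum_congr rfl fun i _ => ?_
      rw [IntermediateField.coe_smul, Algebra.smul_def]
    have haL : a ∈ L := by
      rw [ha_eq]
      exact L.sum_mem fun i _ => L.mul_mem (hrat L htL _) (hbL i)
    exact (Subfield.closure_le (t := (IntermediateField.adjoin ℚ (s : Set K)).toSubfield)).mpr
      (IntermediateField.subset_adjoin ℚ (s : Set K)) haL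
  have hdivN := N.hdiv_of_fixed_subset_adjoin_finset hfgN
  obtain ⟨c₀, hc₀, hc₀nc⟩ := exists_isKappaCoric_rat
  obtain ⟨x₁, x₂, hx, hx₁, hx₂⟩ := hc₀.exists_two_zeroes _ hc₀nc
  have hc₀T : ι c₀ ∈ T := (S.isInftyKappaCoricIn_algebraMap_iff_isKappaCoric K c₀).mpr hc₀
  have hordmulN : ∀ (x : ℚ) (a b : K), a ≠ 0 → b ≠ 0 → (∀ g : G, g • a = a) → (∀ g : G, g • b = b) →
      ordK x (a * b) = ordK x a + ordK x b := by
    intro x a b ha hb hfa hfb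
    obtain ⟨ca, rfl⟩ := hfixed a hfa
    obtain ⟨cb, rfl⟩ := hfixed b hfb
    have hca : ca ≠ 0 := fun h => ha (by rw [h, map_zero])
    have hcb : cb ≠ 0 := fun h => hb (by rw [h, map_zero])
    rw [← map_mul, ord_alg, ord_alg, ord_alg]
    exact ratFunc_ord_mul x hca hcb
  have hpoleTx : ∀ f' ∈ Tx, (∀ g : G, g • f' = f') → ∀ y₁ y₂ : ℚ, y₁ ≠ y₂ → ¬ (ordK y₁ f' < 0 ∧ ordK y₂ f' < 0) := by
    rintro f' ⟨c, hcE, hc0, n, hn, g, hg, hcf⟩ hfix y₁ y₂ hy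
    obtain ⟨q, rfl⟩ := hfixed f' hfix
    have hq0 : q ≠ 0 := by
      rintro rfl
      rw [map_zero, mul_zero, zero_pow hn.ne', eq_comm, map_eq_zero_iff _ hinj] at hcf
      exact hg.ne_zero S hcf
    have hcn : c ^ n = ι (g / q ^ n) := by
      rw [map_div₀, map_pow, ← hcf, mul_pow, mul_div_assoc,
        div_self (pow_ne_zero _ ((map_ne_zero_iff _ hinj).mpr hq0)), mul_one]
    obtain ⟨a, ha⟩ := hconst _ (by rw [← hcn]; exact pow_mem hcE n)
    have ha0 : a ≠ 0 := by
      rintro rfl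
      rw [map_zero, div_eq_zero_iff, pow_eq_zero_iff hn.ne'] at ha
      exact ha.elim (hg.ne_zero S) hq0
    have hqn : q ^ n = RatFunc.C a⁻¹ * g := by
      have h1 : g = RatFunc.C a * q ^ n := by rw [← ha, div_mul_cancel₀ _ (pow_ne_zero _ hq0)]
      rw [h1, ← mul_assoc, ← map_mul, inv_mul_cancel₀ ha0, map_one, one_mul]
    have hord : ∀ y : ℚ, (n : ℤ) * ordF y q = ordF y g := fun y => by
      have h1 := ratFunc_ord_pow y hq0 n
      have h2 := ratFunc_ord_mul y ((_root_.map_ne_zero RatFunc.C).mpr (inv_ne_zero ha0)) (hg.ne_zero S)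
      have h3 := ordF_C y a⁻¹
      simp only [ordF] at h3 ⊢
      rw [← h1, hqn, h2, h3, zero_add]
    rw [ord_alg, ord_alg]
    rintro ⟨h₁, h₂⟩
    have e₁ := hord y₁
    have e₂ := hord y₂
    simp only [ordF] at e₁ e₂ h₁ h₂
    exact hg.not_two_poles S hy ⟨by rw [← e₁]; exact mul_neg_of_pos_of_neg (by exact_mod_cast hn) h₁,
      by rw [← e₂]; exact mul_neg_of_pos_of_neg (by exact_mod_cast hn) h₂⟩
  have h2Tx : (2 : K) ∈ Tx := hconstTx 2 (by exact_mod_cast hratE 2) two_ne_zero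
  have h2T : (2 : K) ∉ T := by
    rintro ⟨n, hn, g, hg, h⟩
    have h2 : ι (RatFunc.C 2) = (2 : K) := by rw [hCK]; norm_num
    have hg2 : g = RatFunc.C 2 ^ n := hinj (by rw [map_pow, h2]; exact h.symm)
    have h0 : (0 : ℚ) ∈ S.pts := by simp [hS]
    obtain ⟨m, hm, hroot⟩ := hg.rootOfUnity_at_critical 0 h0
    rw [hg2, ← map_pow, RatFunc.eval_C, RingHom.id_apply, ← pow_mul] at hroot
    have : (1 : ℚ) < 2 ^ (n * m) := one_lt_pow₀ (by norm_num) (Nat.mul_pos hn hm).ne'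
    exact this.ne' hroot
  refine ⟨N, (inferInstance : CharZero K), ℚ, ordK, ?_, ?_, hfgN, hdivN, hordmulN, hT1, hTpow, ?_,
    ⟨ι c₀, hc₀T, hfix_alg c₀, x₁, x₂, hx, ?_, ?_⟩, hTx1, hTxpow, hpoleTx,
    ⟨ι c₀, hTTx hc₀T, hfix_alg c₀, x₁, x₂, hx, ?_, ?_⟩, ⟨rfl⟩, ⟨fun x => ?_⟩, ⟨Set.ext fun f => ?_⟩,
    Subtype.val_injective, hTTx, fun hTeq => h2T (by rw [show T = Tx from hTeq]; exact h2Tx)⟩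
  · exact fun a _ n hn => IsAlgClosed.exists_pow_nat_eq a hn
  · intro n hn
    haveI : NeZero (n : K) := ⟨Nat.cast_ne_zero.mpr hn.ne'⟩
    exact HasEnoughRootsOfUnity.exists_primitiveRoot K n
  · exact fun f' hf' => hpoleTx f' (hTTx hf')
  · rw [ord_alg]; exact hx₁
  · rw [ord_alg]; exact hx₂
  · rw [ord_alg]; exact hx₁
  · rw [ord_alg]; exact hx₂
  · rw [hconst_apply]
    exact hconstTx _ (x : E).2 (fun h => x.ne_zero (Subtype.ext h))
  · simp only [minfκxUnits, Set.mem_setOf_eq, Set.mem_range]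
    constructor
    · rintro ⟨-, hf, hf'⟩
      obtain ⟨hf0, hfE⟩ := hunits f hf hf'
      exact ⟨Units.mk0 (⟨f, hfE⟩ : E) (fun h => hf0 (congrArg Subtype.val h)), rfl⟩
    · rintro ⟨x, rfl⟩
      have hx0 : ((x : E) : K) ≠ 0 := fun h => x.ne_zero (Subtype.ext h)
      refine ⟨hTx1, hconstTx _ (x : E).2 hx0, ⟨(x : E), (x : E).2, hx0, ?_⟩⟩
      rw [hconst_apply, mul_inv_cancel₀ hx0]
      exact hT1

/-- **BOTH `_of_fg` closers FIRE at the faithful arithmetic model** (typed; answers the «∞κ× closer fires too» remark of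
A3's docstring): abc-iut-w4-d050's `NFBridgeRecon.existsUniqueCoricStructure_infκPair_fieldLevel_of_fg` and
`…_infκxPair_fieldLevel_of_fg` (p447949) applied to the witnesses give `ExistsUniqueCoricStructure π₁^rat 𝕄^⊛_∞κ` AND
`ExistsUniqueCoricStructure π₁^rat 𝕄^⊛_∞κ×` at ONE datum with `𝕄^⊛_∞κ ≠ 𝕄^⊛_∞κ×` and F-2571/F-2572/F-2575 holding there.
NV annex; inhabited ≠ discharged. ([IUTchI] Ex 5.1 (v) p.128) [claim: Mochizuki2012, status: disputed] -/
theorem exists_faithful_fieldLevel_of_fg_fire_arithmetic :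
    ∃ (N : NFBridgeRecon.{0}) (_ : CharZero N.Krat),
      N.Minfκ ≠ N.Minfκx ∧ N.MκIsInvariants ∧ N.ConstantsInfκx ∧ N.InfκxUnitsEqConstants ∧
      ExistsUniqueCoricStructure N.piRat N.infκPair ∧ ExistsUniqueCoricStructure N.piRat N.infκxPair := by
  obtain ⟨N, hc, X, ord, hroot, hprim, hfg, -, hordmul, h1, hpow, hpole, hex, h1x, hpowx, hpolex, hexx,
    hκ, hconst, hunits, -, -, hne⟩ := exists_faithful_fieldLevel_laws_arithmetic
  haveI := hc
  exact ⟨N, hc, hne, hκ, hconst, hunits,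
    N.existsUniqueCoricStructure_infκPair_fieldLevel_of_fg hroot hprim h1 hpow hfg ord hordmul hpole hex,
    N.existsUniqueCoricStructure_infκxPair_fieldLevel_of_fg hroot hprim h1x hpowx hfg ord hordmul hpolex hexx⟩

end CoricArithmeticToy

end NFBridgeRecon

end Literature.IUT.HodgeTheaters

end
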